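import Literature.NumberTheory.EllipticCurves.Gamma1NewformLSeriesFrickeProofs
import Literature.NumberTheory.EllipticCurves.HeckeOperatorsGamma1QExpansionProofs
import Literature.NumberTheory.EllipticCurves.HeckeEisensteinWeightOneForm
import Literature.NumberTheory.EllipticCurves.ModularCurveGammaIndex
import HarnessLib

/-!
# Cusp forms of level `Γ₁(N)` from `q`-series with polynomially bounded coefficients

A holomorphic function `f = ∑_{n ≥ 1} aₙ qⁿ` on `ℍ` with `|aₙ| ≤ C n^r`, transforming under
`Γ₀(N)` by `f ∣ₖ γ = χ(d_γ) f`, is a cusp form of weight `k` in `S_k(N, χ)` as soon as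
`r + 1 < k`: the growth `|f(τ)| ≤ K (Im τ)^{-(r+1)}` near the real axis (Diamond–Shurman,
Exercise 1.2.6(a); Miyake, Lemma 4.3.3) forces `f ∣ₖ A → 0` at `i∞` for every `A ∈ SL₂(ℤ)`
(Miyake, Thm. 2.1.4; the cusp-form case of Diamond–Shurman Prop. 1.2.4).  This is the analytic
packaging step common to both classical constructions of the CM newform of a Hecke character
(theta series; Weil's converse theorem), which produce exactly such a `q`-series together with its
`Γ₀(N)`-transformation law (Miyake, Thm. 4.8.2).

## Main statements

* `exists_tsum_rpow_mul_exp_le` — `∑_{n ≥ 1} nʳ e^{-2πny} ≤ K y^{-(r+1)}` (`y > 0`).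
* `norm_le_mul_im_rpow_neg_of_hasSum` — `|f(τ)| ≤ K (Im τ)^{-(r+1)}` for `f = ∑ aₙ qⁿ`,
  `|aₙ| ≤ C nʳ`, `a₀ = 0`.
* `isZeroAtImInfty_slash_of_norm_le`, `isZeroAtImInfty_slash_of_coeff_bound` — such an `f`,
  weight-`k` invariant under `Γ(N)` with `r + 1 < k`, has `f ∣ₖ A → 0` at `i∞` for every
  `A ∈ SL₂(ℤ)`.
* `exists_cuspForm_of_hasSum` — packaging as a cusp form `g ∈ S_k(Γ₁(N))` in the `χ`-eigenspace
  `nebentypusSubspace N k χ`, with `⇑g = f` and `q`-expansion coefficients `aₙ`.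

## References

* F. Diamond, J. Shurman, *A First Course in Modular Forms*, GTM 228 (2005), Prop. 1.2.4 and
  Exercise 1.2.6. [DiamondShurman2005]
* T. Miyake, *Modular Forms*, Springer (2006), Thm. 2.1.4, Lemma 4.3.3, Thm. 4.8.2. [Miyake2006]
-/

noncomputable section

open Complex UpperHalfPlane Filter CongruenceSubgroup ModularForm Matrix Matrix.SpecialLinearGroup
open scoped Real Topology MatrixGroups Manifold

namespace Literature.NumberTheory.EllipticCurves.ModularForms

/-! ### Elementary bounds: `xʳ e^{-x}` and `∑ e^{-b(n+1)}` -/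

/-- `xʳ e^{-x} ≤ max 1 (rʳ e^{-r})` for `x ≥ 0`, `r ≥ 0` (the maximum of `xʳe^{-x}` is at `x = r`).
[folklore] -/
theorem rpow_mul_exp_neg_le_max {r x : ℝ} (hr : 0 ≤ r) (hx : 0 ≤ x) :
    x ^ r * Real.exp (-x) ≤ max 1 (r ^ r * Real.exp (-r)) := by
  rcases hr.eq_or_lt with rfl | hr0
  · rw [Real.rpow_zero, one_mul]
    exact (Real.exp_le_one_iff.mpr (by linarith)).trans (le_max_left _ _)
  rcases hx.eq_or_lt with rfl | hx0
  · rw [Real.zero_rpow hr0.ne', zero_mul]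
    exact zero_le_one.trans (le_max_left _ _)
  refine le_trans ?_ (le_max_right _ _)
  -- `log (x/r) ≤ x/r - 1`
  have h1 := Real.log_le_sub_one_of_pos (div_pos hx0 hr0)
  rw [Real.log_div hx0.ne' hr0.ne'] at h1
  have h2 : r * Real.log x - x ≤ r * Real.log r - r := by
    have h3 : r * (Real.log x - Real.log r) ≤ r * (x / r - 1) := mul_le_mul_of_nonneg_left h1 hr0.le
    have h4 : r * (x / r - 1) = x - r := by field_simp
    linarith
  have e1 : x ^ r * Real.exp (-x) = Real.exp (r * Real.log x - x) := by
    rw [Real.rpow_def_of_pos hx0, ← Real.exp_add]; ring_nf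
  have e2 : r ^ r * Real.exp (-r) = Real.exp (r * Real.log r - r) := by
    rw [Real.rpow_def_of_pos hr0, ← Real.exp_add]; ring_nf
  rw [e1, e2]
  exact Real.exp_le_exp.mpr h2

/-- `∑_{n ≥ 0} e^{-b(n+1)} = 1/(eᵇ - 1) ≤ 1/b` for `b > 0`. [folklore] -/
theorem hasSum_exp_neg_mul_succ {b : ℝ} (hb : 0 < b) :
    HasSum (fun n : ℕ => Real.exp (-(b * (n + 1)))) (Real.exp (-b) / (1 - Real.exp (-b))) := by
  have hq0 : 0 ≤ Real.exp (-b) := (Real.exp_pos _).le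
  have hq1 : Real.exp (-b) < 1 := Real.exp_lt_one_iff.mpr (by linarith)
  have h := (hasSum_geometric_of_lt_one hq0 hq1).mul_left (Real.exp (-b))
  rw [← div_eq_mul_inv] at h
  refine h.congr_fun fun n => ?_
  rw [← Real.exp_nat_mul, ← Real.exp_add]
  congr 1; ring

/-- `∑_{n ≥ 0} e^{-b(n+1)} ≤ 1/b` for `b > 0`. [folklore] -/
theorem tsum_exp_neg_mul_succ_le {b : ℝ} (hb : 0 < b) :
    ∑' n : ℕ, Real.exp (-(b * (n + 1))) ≤ b⁻¹ := by
  rw [(hasSum_exp_neg_mul_succ hb).tsum_eq]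
  have h1 : 0 < 1 - Real.exp (-b) := by
    have := Real.exp_lt_one_iff.mpr (show -b < 0 by linarith); linarith
  rw [div_le_iff₀ h1]
  -- want `e^{-b} ≤ b⁻¹ (1 - e^{-b})`, i.e. `(b + 1) e^{-b} ≤ 1`
  have h2 : (b + 1) * Real.exp (-b) ≤ 1 := by
    have h3 : b + 1 ≤ Real.exp b := by linarith [Real.add_one_le_exp b]
    calc (b + 1) * Real.exp (-b) ≤ Real.exp b * Real.exp (-b) :=
          mul_le_mul_of_nonneg_right h3 (Real.exp_pos _).le
      _ = 1 := by rw [← Real.exp_add, add_neg_cancel, Real.exp_zero]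
  have hb' : 0 < b⁻¹ := inv_pos.mpr hb
  have e : b⁻¹ * (1 - Real.exp (-b)) = Real.exp (-b) + b⁻¹ * (1 - (b + 1) * Real.exp (-b)) := by
    field_simp; ring
  rw [e, le_add_iff_nonneg_right]
  exact mul_nonneg hb'.le (by linarith)

/-! ### `∑_{n ≥ 1} nʳ e^{-2πny} ≪ y^{-(r+1)}` (Diamond–Shurman Ex. 1.2.6(a); Miyake Lemma 4.3.3) -/

/-- **`∑_{n ≥ 1} nʳ e^{-2πny} ≤ K y^{-(r+1)}` for all `y > 0`** (`r ≥ 0`; Diamond–Shurman,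
Exercise 1.2.6(a): the sum is `≪ ∫₀^∞ tʳ e^{-2πty} dt + y^{-r} ≪ y^{-(r+1)}`; here via
`nʳ e^{-πny} ≤ M (πy)^{-r}` and `∑ e^{-πny} ≤ (πy)^{-1}`). [cite: DiamondShurman2005, Exercise 1.2.6(a)] -/
theorem exists_tsum_rpow_mul_exp_le {r : ℝ} (hr : 0 ≤ r) :
    ∃ K : ℝ, 0 ≤ K ∧ ∀ y : ℝ, 0 < y →
      Summable (fun n : ℕ => ((n : ℝ) + 1) ^ r * Real.exp (-(2 * π * ((n : ℝ) + 1) * y))) ∧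
      ∑' n : ℕ, ((n : ℝ) + 1) ^ r * Real.exp (-(2 * π * ((n : ℝ) + 1) * y)) ≤ K * y ^ (-(r + 1)) := by
  set M : ℝ := max 1 (r ^ r * Real.exp (-r)) with hM
  have hM0 : 0 ≤ M := zero_le_one.trans (le_max_left _ _)
  refine ⟨M * π ^ (-(r + 1)), by positivity, fun y hy => ?_⟩
  have hπy : 0 < π * y := mul_pos Real.pi_pos hy
  -- termwise bound: `(n+1)^r e^{-2π(n+1)y} ≤ M (πy)^{-r} e^{-π y (n+1)}`
  have hterm : ∀ n : ℕ, ((n : ℝ) + 1) ^ r * Real.exp (-(2 * π * ((n : ℝ) + 1) * y)) ≤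
      M * (π * y) ^ (-r) * Real.exp (-(π * y * ((n : ℝ) + 1))) := by
    intro n
    have hn : (0 : ℝ) ≤ (n : ℝ) + 1 := by positivity
    have hx : 0 ≤ π * y * ((n : ℝ) + 1) := by positivity
    have h1 := rpow_mul_exp_neg_le_max hr hx
    rw [← hM, Real.mul_rpow hπy.le hn] at h1
    -- `h1 : (πy)^r (n+1)^r e^{-πy(n+1)} ≤ M`
    have e : Real.exp (-(2 * π * ((n : ℝ) + 1) * y)) =
        Real.exp (-(π * y * ((n : ℝ) + 1))) * Real.exp (-(π * y * ((n : ℝ) + 1))) := by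
      rw [← Real.exp_add]; congr 1; ring
    rw [e, ← mul_assoc]
    refine mul_le_mul_of_nonneg_right ?_ (Real.exp_pos _).le
    have hπyr : 0 < (π * y) ^ r := Real.rpow_pos_of_pos hπy r
    rw [Real.rpow_neg hπy.le, ← div_eq_mul_inv, le_div_iff₀ hπyr]
    calc ((n : ℝ) + 1) ^ r * Real.exp (-(π * y * ((n : ℝ) + 1))) * (π * y) ^ r
        = (π * y) ^ r * ((n : ℝ) + 1) ^ r * Real.exp (-(π * y * ((n : ℝ) + 1))) := by ring
      _ ≤ M := h1
  have hmaj : Summable fun n : ℕ => M * (π * y) ^ (-r) * Real.exp (-(π * y * ((n : ℝ) + 1))) :=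
    (hasSum_exp_neg_mul_succ hπy).summable.mul_left _
  have hnonneg : ∀ n : ℕ, 0 ≤ ((n : ℝ) + 1) ^ r * Real.exp (-(2 * π * ((n : ℝ) + 1) * y)) :=
    fun n => by positivity
  have hsum : Summable fun n : ℕ => ((n : ℝ) + 1) ^ r * Real.exp (-(2 * π * ((n : ℝ) + 1) * y)) :=
    Summable.of_nonneg_of_le hnonneg hterm hmaj
  refine ⟨hsum, ?_⟩
  calc ∑' n : ℕ, ((n : ℝ) + 1) ^ r * Real.exp (-(2 * π * ((n : ℝ) + 1) * y))
      ≤ ∑' n : ℕ, M * (π * y) ^ (-r) * Real.exp (-(π * y * ((n : ℝ) + 1))) :=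
        hsum.tsum_le_tsum hterm hmaj
    _ = M * (π * y) ^ (-r) * ∑' n : ℕ, Real.exp (-(π * y * ((n : ℝ) + 1))) := tsum_mul_left
    _ ≤ M * (π * y) ^ (-r) * (π * y)⁻¹ :=
        mul_le_mul_of_nonneg_left (tsum_exp_neg_mul_succ_le hπy) (by positivity)
    _ = M * π ^ (-(r + 1)) * y ^ (-(r + 1)) := by
        rw [Real.mul_rpow Real.pi_pos.le hy.le, Real.rpow_neg Real.pi_pos.le (r + 1),
          Real.rpow_neg hy.le (r + 1), Real.rpow_add Real.pi_pos, Real.rpow_add hy,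
          Real.rpow_one, Real.rpow_one, Real.rpow_neg Real.pi_pos.le, Real.rpow_neg hy.le]
        field_simp

/-! ### `|f(τ)| ≪ (Im τ)^{-(r+1)}` for `f = ∑_{n ≥ 1} aₙ qⁿ`, `|aₙ| ≤ C nʳ` -/

/-- **Growth of a `q`-series near the real axis** (Diamond–Shurman, Exercise 1.2.6(a); Miyake,
Lemma 4.3.3): if `f(τ) = ∑_{n ≥ 1} aₙ e^{2πinτ}` with `|aₙ| ≤ C nʳ` (`r ≥ 0`), then
`|f(τ)| ≤ K (Im τ)^{-(r+1)}` on all of `ℍ`. [cite: DiamondShurman2005, Exercise 1.2.6(a)] -/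
theorem norm_le_mul_im_rpow_neg_of_hasSum {f : ℍ → ℂ} {a : ℕ → ℂ} {C r : ℝ} (hr : 0 ≤ r)
    (ha : ∀ n, ‖a n‖ ≤ C * (n : ℝ) ^ r) (ha0 : a 0 = 0)
    (hf : ∀ τ : ℍ, HasSum (fun n : ℕ => a n * Function.Periodic.qParam 1 τ ^ n) (f τ)) :
    ∃ K : ℝ, 0 ≤ K ∧ ∀ τ : ℍ, ‖f τ‖ ≤ K * τ.im ^ (-(r + 1)) := by
  obtain ⟨K₀, hK₀, hK⟩ := exists_tsum_rpow_mul_exp_le hr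
  have hC : 0 ≤ C := by
    have h := (norm_nonneg (a 1)).trans (ha 1)
    simpa using h
  refine ⟨C * K₀, by positivity, fun τ => ?_⟩
  have hy : 0 < τ.im := τ.im_pos
  obtain ⟨hsum, hle⟩ := hK τ.im hy
  -- drop the vanishing `n = 0` term
  have hf1 : HasSum (fun n : ℕ => a (n + 1) * Function.Periodic.qParam 1 τ ^ (n + 1)) (f τ) := by
    have h := (hasSum_nat_add_iff' (f := fun n : ℕ => a n * Function.Periodic.qParam 1 τ ^ n) 1).mpr (hf τ)
    simpa [ha0] using h
  have hmaj : HasSum (fun n : ℕ => C * (((n : ℝ) + 1) ^ r * Real.exp (-(2 * π * ((n : ℝ) + 1) * τ.im))))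
      (C * ∑' n : ℕ, ((n : ℝ) + 1) ^ r * Real.exp (-(2 * π * ((n : ℝ) + 1) * τ.im))) :=
    hsum.hasSum.mul_left C
  have hq : ∀ n : ℕ, ‖Function.Periodic.qParam 1 (τ : ℂ) ^ (n + 1)‖ = Real.exp (-(2 * π * ((n : ℝ) + 1) * τ.im)) := by
    intro n
    rw [norm_pow, Function.Periodic.norm_qParam, div_one, ← Real.exp_nat_mul, UpperHalfPlane.coe_im]
    congr 1; push_cast; ring
  have hbound : ∀ n : ℕ, ‖a (n + 1) * Function.Periodic.qParam 1 τ ^ (n + 1)‖ ≤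
      C * (((n : ℝ) + 1) ^ r * Real.exp (-(2 * π * ((n : ℝ) + 1) * τ.im))) := by
    intro n
    rw [norm_mul, hq, ← mul_assoc]
    refine mul_le_mul_of_nonneg_right ?_ (Real.exp_pos _).le
    have h := ha (n + 1)
    push_cast at h
    exact h
  calc ‖f τ‖ ≤ C * ∑' n : ℕ, ((n : ℝ) + 1) ^ r * Real.exp (-(2 * π * ((n : ℝ) + 1) * τ.im)) :=
        hf1.norm_le_of_bounded hmaj hbound
    _ ≤ C * (K₀ * τ.im ^ (-(r + 1))) := mul_le_mul_of_nonneg_left hle hC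
    _ = C * K₀ * τ.im ^ (-(r + 1)) := by ring

/-! ### The translates `f ∣ₖ g`, `g ∈ SL₂(ℤ)` -/

/-- `|cτ + d|²` for `g = (a b; c d) ∈ SL₂(ℤ)`: `normSq (denom g τ) = (c Re τ + d)² + (c Im τ)²`.
[folklore] -/
theorem normSq_denom_eq (g : SL(2, ℤ)) (τ : ℍ) :
    Complex.normSq (denom g τ) =
      ((g 1 0 : ℝ) * τ.re + (g 1 1 : ℝ)) ^ 2 + ((g 1 0 : ℝ) * τ.im) ^ 2 := by
  rw [ModularGroup.denom_apply, Complex.normSq_apply]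
  simp only [Complex.add_re, Complex.mul_re, Complex.intCast_re, Complex.intCast_im, zero_mul,
    sub_zero, Complex.add_im, Complex.mul_im, add_zero, UpperHalfPlane.coe_re, UpperHalfPlane.coe_im]
  ring

/-- For `g ∈ SL₂(ℤ)` with `c = 0`: `|denom g τ|² = 1` (`d = ±1`). [folklore] -/
theorem normSq_denom_eq_one_of_apply_eq_zero {g : SL(2, ℤ)} (hc : g 1 0 = 0) (τ : ℍ) :
    Complex.normSq (denom g τ) = 1 := by
  have hdet := g.det_coe
  rw [Matrix.det_fin_two, hc, mul_zero, sub_zero] at hdet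
  have hd : (g 1 1 : ℤ) ^ 2 = 1 := by
    rcases Int.eq_one_or_neg_one_of_mul_eq_one' hdet with ⟨-, h⟩ | ⟨-, h⟩ <;> simp [h]
  rw [normSq_denom_eq, hc]
  have : ((g 1 1 : ℤ) : ℝ) ^ 2 = 1 := by exact_mod_cast hd
  push_cast
  nlinarith [this]

/-- For `g ∈ SL₂(ℤ)` with `c ≠ 0`, on the half-strip `|Re τ| ≤ B`, `Im τ ≥ 1`:
`(Im τ)² ≤ |denom g τ|² ≤ L (Im τ)²` with `L = (|c| B + |d|)² + c²`. [folklore] -/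
theorem sq_im_le_normSq_denom {g : SL(2, ℤ)} (hc : g 1 0 ≠ 0) (τ : ℍ) :
    τ.im ^ 2 ≤ Complex.normSq (denom g τ) := by
  rw [normSq_denom_eq]
  have h1 : (1 : ℝ) ≤ ((g 1 0 : ℤ) : ℝ) ^ 2 := by
    have : (1 : ℤ) ≤ (g 1 0 : ℤ) ^ 2 := by
      have := Int.one_le_abs hc
      nlinarith [sq_abs (g 1 0 : ℤ)]
    exact_mod_cast this
  have hy := τ.im_pos
  nlinarith [sq_nonneg (((g 1 0 : ℤ) : ℝ) * τ.re + ((g 1 1 : ℤ) : ℝ)), sq_nonneg τ.im]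

/-- Upper bound `|denom g τ|² ≤ ((|c| B + |d|)² + c²) (Im τ)²` on `|Re τ| ≤ B`, `Im τ ≥ 1`.
[folklore] -/
theorem normSq_denom_le (g : SL(2, ℤ)) {B : ℝ} {τ : ℍ} (hB : |τ.re| ≤ B) (hy : 1 ≤ τ.im) :
    Complex.normSq (denom g τ) ≤
      ((|((g 1 0 : ℤ) : ℝ)| * B + |((g 1 1 : ℤ) : ℝ)|) ^ 2 + ((g 1 0 : ℤ) : ℝ) ^ 2) * τ.im ^ 2 := by
  rw [normSq_denom_eq]
  set c : ℝ := ((g 1 0 : ℤ) : ℝ)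
  set d : ℝ := ((g 1 1 : ℤ) : ℝ)
  have hB0 : 0 ≤ B := (abs_nonneg _).trans hB
  have h1 : |c * τ.re + d| ≤ |c| * B + |d| := by
    calc |c * τ.re + d| ≤ |c * τ.re| + |d| := abs_add_le _ _
      _ = |c| * |τ.re| + |d| := by rw [abs_mul]
      _ ≤ |c| * B + |d| := by gcongr
  have h2 : (c * τ.re + d) ^ 2 ≤ (|c| * B + |d|) ^ 2 := by
    calc (c * τ.re + d) ^ 2 = |c * τ.re + d| ^ 2 := (sq_abs _).symm
      _ ≤ (|c| * B + |d|) ^ 2 := by gcongr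
  have h3 : (|c| * B + |d|) ^ 2 ≤ (|c| * B + |d|) ^ 2 * τ.im ^ 2 := by
    have : (1 : ℝ) ≤ τ.im ^ 2 := by nlinarith
    exact le_mul_of_one_le_right (sq_nonneg _) this
  nlinarith [h2, h3]

/-- `θᵉ ≤ Lᵉ'` bookkeeping: for `1 ≤ θ ≤ L` and any real `e`, `θᵉ ≤ (max L 1)^{|e|}`. [folklore] -/
theorem rpow_le_max_rpow_abs {θ L e : ℝ} (h1 : 1 ≤ θ) (h2 : θ ≤ L) :
    θ ^ e ≤ (max L 1) ^ |e| := by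
  have hL1 : 1 ≤ max L 1 := le_max_right _ _
  rcases le_or_gt 0 e with he | he
  · rw [abs_of_nonneg he]
    exact Real.rpow_le_rpow (by linarith) (h2.trans (le_max_left _ _)) he
  · rw [abs_of_neg he]
    calc θ ^ e ≤ 1 := Real.rpow_le_one_of_one_le_of_nonpos h1 he.le
      _ ≤ (max L 1) ^ (-e) := Real.one_le_rpow hL1 (by linarith)

/-- Exponent bookkeeping: `(D/y)^{r+1} D^{-k/2} = (D/y²)^{r+1-k/2} y^{r+1-k}` (`D, y > 0`).
[folklore] -/
theorem div_rpow_mul_rpow_eq {D y : ℝ} (hD : 0 < D) (hy : 0 < y) (r k : ℝ) :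
    (D / y) ^ (r + 1) * D ^ (-k / 2) = (D / y ^ 2) ^ (r + 1 - k / 2) * y ^ (r + 1 - k) := by
  obtain ⟨θ, hθ, rfl⟩ : ∃ θ : ℝ, 0 < θ ∧ D = θ * y ^ 2 :=
    ⟨D / y ^ 2, by positivity, by field_simp⟩
  have h1 : θ * y ^ 2 / y = θ * y := by field_simp
  have h2 : θ * y ^ 2 / y ^ 2 = θ := by field_simp
  have hy2 : (y ^ 2 : ℝ) ^ (-k / 2) = y ^ (-k) := by
    rw [← Real.rpow_natCast, ← Real.rpow_mul hy.le]; congr 1; push_cast; ring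
  rw [h1, h2, Real.mul_rpow hθ.le hy.le, Real.mul_rpow hθ.le (by positivity), hy2,
    show r + 1 - k / 2 = (r + 1) + (-k / 2) by ring, Real.rpow_add hθ (r + 1) (-k / 2),
    show r + 1 - k = (r + 1) + (-k) by ring, Real.rpow_add hy (r + 1) (-k)]
  ring

/-- **Strip estimate for `f ∣ₖ g`, `c ≠ 0`**: if `|f(τ)| ≤ K (Im τ)^{-(r+1)}` on `ℍ` then for
`g ∈ SL₂(ℤ)` with `c ≠ 0`, on `|Re τ| ≤ B`, `Im τ ≥ 1`:
`|(f ∣ₖ g)(τ)| ≤ K' (Im τ)^{r+1-k}` (Diamond–Shurman, Exercise 1.2.6(b): `Im(gτ) = Im τ/|cτ+d|²`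
and `|cτ + d| ≍ Im τ` there). [cite: DiamondShurman2005, Exercise 1.2.6(b)] -/
theorem norm_slash_le_of_apply_ne_zero {f : ℍ → ℂ} {k : ℤ} {K r : ℝ} (hK : 0 ≤ K)
    (hb : ∀ τ : ℍ, ‖f τ‖ ≤ K * τ.im ^ (-(r + 1))) {g : SL(2, ℤ)} (hc : g 1 0 ≠ 0) (B : ℝ) :
    ∃ K' : ℝ, 0 ≤ K' ∧ ∀ τ : ℍ, |τ.re| ≤ B → 1 ≤ τ.im →
      ‖(f ∣[k] g) τ‖ ≤ K' * τ.im ^ (r + 1 - k) := by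
  set L : ℝ := (|((g 1 0 : ℤ) : ℝ)| * B + |((g 1 1 : ℤ) : ℝ)|) ^ 2 + ((g 1 0 : ℤ) : ℝ) ^ 2 with hL
  set e : ℝ := r + 1 - (k : ℝ) / 2 with he
  refine ⟨K * (max L 1) ^ |e|, by positivity, fun τ hB hy1 => ?_⟩
  have hy : 0 < τ.im := τ.im_pos
  set D2 : ℝ := Complex.normSq (denom g τ) with hD2
  have hD2pos : 0 < D2 := by
    have := sq_im_le_normSq_denom hc τ; rw [← hD2] at this; nlinarith
  have hnorm : ‖denom g τ‖ = D2 ^ ((1 : ℝ) / 2) := by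
    rw [hD2, Complex.normSq_eq_norm_sq, ← Real.sqrt_eq_rpow, Real.sqrt_sq (norm_nonneg _)]
  -- `Im (g • τ) = Im τ / D2`
  have him : (g • τ).im = τ.im / D2 := ModularGroup.im_smul_eq_div_normSq g τ
  -- the value of `f`
  have hfval : ‖f (g • τ)‖ ≤ K * (D2 / τ.im) ^ (r + 1) := by
    have h := hb (g • τ)
    rw [him, Real.rpow_neg (div_pos hy hD2pos).le, ← Real.inv_rpow (div_pos hy hD2pos).le,
      inv_div] at h
    exact h
  -- the automorphy factor
  have hden : ‖denom g τ ^ (-k)‖ = D2 ^ (-(k : ℝ) / 2) := by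
    rw [norm_zpow, hnorm, ← Real.rpow_intCast, ← Real.rpow_mul hD2pos.le]
    congr 1; push_cast; ring
  rw [ModularForm.SL_slash_apply, norm_mul, hden]
  -- `1 ≤ D2 / y² ≤ L`
  have hθ1 : 1 ≤ D2 / τ.im ^ 2 := by
    rw [le_div_iff₀ (by positivity), one_mul]; exact sq_im_le_normSq_denom hc τ
  have hθ2 : D2 / τ.im ^ 2 ≤ L := by
    rw [div_le_iff₀ (by positivity)]; exact normSq_denom_le g hB hy1
  have hθ := rpow_le_max_rpow_abs (e := e) hθ1 hθ2
  -- rewrite everything in terms of `θ = D2 / y²` and `y`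
  have key : (D2 / τ.im) ^ (r + 1) * D2 ^ (-(k : ℝ) / 2) =
      (D2 / τ.im ^ 2) ^ e * τ.im ^ (r + 1 - k) := by
    rw [he]; exact div_rpow_mul_rpow_eq hD2pos hy r k
  calc ‖f (g • τ)‖ * D2 ^ (-(k : ℝ) / 2)
      ≤ K * (D2 / τ.im) ^ (r + 1) * D2 ^ (-(k : ℝ) / 2) :=
        mul_le_mul_of_nonneg_right hfval (Real.rpow_nonneg hD2pos.le _)
    _ = K * ((D2 / τ.im ^ 2) ^ e * τ.im ^ (r + 1 - k)) := by rw [mul_assoc, key]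
    _ ≤ K * ((max L 1) ^ |e| * τ.im ^ (r + 1 - k)) := by
        gcongr
    _ = K * (max L 1) ^ |e| * τ.im ^ (r + 1 - k) := by ring

/-- **The case `c = 0`**: `|(f ∣ₖ g)(τ)| = |f(g τ)| ≤ K (Im τ)^{-(r+1)}` (`g τ = τ ± b`).
[cite: DiamondShurman2005, Exercise 1.2.6(b)] -/
theorem norm_slash_le_of_apply_eq_zero {f : ℍ → ℂ} {k : ℤ} {K r : ℝ}
    (hb : ∀ τ : ℍ, ‖f τ‖ ≤ K * τ.im ^ (-(r + 1))) {g : SL(2, ℤ)} (hc : g 1 0 = 0) (τ : ℍ) :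
    ‖(f ∣[k] g) τ‖ ≤ K * τ.im ^ (-(r + 1)) := by
  have hD2 := normSq_denom_eq_one_of_apply_eq_zero hc τ
  have hnorm : ‖denom g τ‖ = 1 := by
    rw [← Real.sqrt_sq (norm_nonneg (denom g τ)), ← Complex.normSq_eq_norm_sq, hD2, Real.sqrt_one]
  have him : (g • τ).im = τ.im := by
    rw [ModularGroup.im_smul_eq_div_normSq g τ, hD2, div_one]
  rw [ModularForm.SL_slash_apply, norm_mul, norm_zpow, hnorm, _root_.one_zpow, mul_one, ← him]
  exact hb _

/-! ### Vanishing at every cusp (Miyake Thm. 2.1.4; Diamond–Shurman Prop. 1.2.4, cusp case) -/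

/-- `g Tᵐ g⁻¹ ∈ Γ(N)` for `N ∣ m` (`Γ(N)` is normal in `SL₂(ℤ)`). [folklore] -/
theorem conj_T_zpow_mem_Gamma {N : ℕ} (g : SL(2, ℤ)) {m : ℤ} (hm : (N : ℤ) ∣ m) :
    g * ModularGroup.T ^ m * g⁻¹ ∈ CongruenceSubgroup.Gamma N := by
  have hT : ModularGroup.T ^ m ∈ CongruenceSubgroup.Gamma N := by
    simpa using ModularGroup_T_pow_mem_Gamma (N : ℤ) m hm
  exact (Gamma_normal N).conj_mem _ hT g

/-- A weight-`k` `Γ(N)`-invariant `f` has `N`-periodic translates: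
`(f ∣ₖ g)(τ + m) = (f ∣ₖ g)(τ)` for `N ∣ m`, `g ∈ SL₂(ℤ)` (Diamond–Shurman, Exercise 1.2.6(b):
`Γ(N) ⊆ g⁻¹ Γ g`). [cite: DiamondShurman2005, Exercise 1.2.6(b)] -/
theorem slash_apply_vadd_of_forall_gamma {N : ℕ} {f : ℍ → ℂ} {k : ℤ}
    (hinv : ∀ γ ∈ CongruenceSubgroup.Gamma N, f ∣[k] γ = f) (g : SL(2, ℤ)) {m : ℤ}
    (hm : (N : ℤ) ∣ m) (τ : ℍ) :
    (f ∣[k] g) ((m : ℝ) +ᵥ τ) = (f ∣[k] g) τ := by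
  have h1 : f ∣[k] (g * ModularGroup.T ^ m * g⁻¹) = f := hinv _ (conj_T_zpow_mem_Gamma g hm)
  have h2 : (f ∣[k] g) ∣[k] (ModularGroup.T ^ m) = f ∣[k] g := by
    calc (f ∣[k] g) ∣[k] (ModularGroup.T ^ m) = f ∣[k] ((g * ModularGroup.T ^ m * g⁻¹) * g) := by
          rw [← SlashAction.slash_mul]; congr 1; group
      _ = f ∣[k] g := by rw [SlashAction.slash_mul, h1]
  have h3 := congr_fun h2 τ
  rw [ModularForm.SL_slash_apply, ModularGroup.denom_apply] at h3
  have hT : ((ModularGroup.T ^ m : SL(2, ℤ)) 1 0 : ℤ) = 0 ∧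
      ((ModularGroup.T ^ m : SL(2, ℤ)) 1 1 : ℤ) = 1 := by
    simp [ModularGroup.coe_T_zpow]
  rw [hT.1, hT.2, UpperHalfPlane.modular_T_zpow_smul] at h3
  simpa using h3

/-- Reduction of `Re τ` modulo `N`: `|Re (τ - N⌊Re τ / N⌋)| ≤ N`. [folklore] -/
theorem abs_re_vadd_le {N : ℕ} (hN : 0 < N) (τ : ℍ) :
    |((((-((N : ℤ) * ⌊τ.re / N⌋) : ℤ) : ℝ)) +ᵥ τ).re| ≤ N := by
  rw [UpperHalfPlane.vadd_re]
  have hN' : (0 : ℝ) < N := Nat.cast_pos.mpr hN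
  have h1 := Int.floor_le (τ.re / N)
  have h2 := Int.lt_floor_add_one (τ.re / N)
  have e : (N : ℝ) * (τ.re / N) = τ.re := mul_div_cancel₀ _ hN'.ne'
  have h1' : (N : ℝ) * ⌊τ.re / N⌋ ≤ τ.re := by
    have := mul_le_mul_of_nonneg_left h1 hN'.le; rwa [e] at this
  have h2' : τ.re < (N : ℝ) * (⌊τ.re / N⌋ + 1) := by
    have := mul_lt_mul_of_pos_left h2 hN'; rwa [e] at this
  rw [abs_le]
  push_cast
  constructor <;> nlinarith

/-- **Vanishing at all cusps from growth** (Miyake, Thm. 2.1.4 (1); the cusp-form case of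
Diamond–Shurman Prop. 1.2.4 / Exercise 1.2.6(b)): if `f` is weight-`k` invariant under `Γ(N)`
and `|f(τ)| ≤ K (Im τ)^{-(r+1)}` on `ℍ` with `r + 1 < k`, then `f ∣ₖ g → 0` at `i∞` for every
`g ∈ SL₂(ℤ)`. [cite: DiamondShurman2005, Prop. 1.2.4 and Exercise 1.2.6] -/
theorem isZeroAtImInfty_slash_of_norm_le {N : ℕ} [NeZero N] {f : ℍ → ℂ} {k : ℤ} {K r : ℝ}
    (hK : 0 ≤ K) (hr : 0 ≤ r) (hrk : r + 1 < k)
    (hb : ∀ τ : ℍ, ‖f τ‖ ≤ K * τ.im ^ (-(r + 1)))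
    (hinv : ∀ γ ∈ CongruenceSubgroup.Gamma N, f ∣[k] γ = f) (g : SL(2, ℤ)) :
    IsZeroAtImInfty (f ∣[k] g) := by
  rw [UpperHalfPlane.isZeroAtImInfty_iff]
  intro ε hε
  by_cases hc : g 1 0 = 0
  · -- `c = 0`: `‖(f ∣ g) τ‖ ≤ K (Im τ)^{-(r+1)} → 0`
    have hlim : Tendsto (fun y : ℝ => K * y ^ (-(r + 1))) atTop (𝓝 0) := by
      simpa using (tendsto_rpow_neg_atTop (by linarith : 0 < r + 1)).const_mul K
    obtain ⟨A₀, hA₀⟩ := Filter.eventually_atTop.mp (hlim.eventually (eventually_le_nhds hε))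
    refine ⟨A₀, fun τ hτ => ?_⟩
    exact (norm_slash_le_of_apply_eq_zero hb hc τ).trans (hA₀ τ.im hτ)
  · -- `c ≠ 0`: reduce to the strip `|Re τ| ≤ N` by `N`-periodicity, then use the strip estimate
    obtain ⟨K', hK'0, hK'⟩ := norm_slash_le_of_apply_ne_zero (k := k) hK hb hc (N : ℝ)
    have hlim : Tendsto (fun y : ℝ => K' * y ^ (r + 1 - k)) atTop (𝓝 0) := by
      have h := (tendsto_rpow_neg_atTop (by linarith : 0 < (k : ℝ) - (r + 1))).const_mul K'
      rw [mul_zero] at h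
      refine h.congr fun y => ?_
      rw [show -((k : ℝ) - (r + 1)) = r + 1 - k by ring]
    obtain ⟨A₀, hA₀⟩ := Filter.eventually_atTop.mp (hlim.eventually (eventually_le_nhds hε))
    refine ⟨max A₀ 1, fun τ hτ => ?_⟩
    have hA₀τ : A₀ ≤ τ.im := le_of_max_le_left hτ
    have h1τ : 1 ≤ τ.im := le_of_max_le_right hτ
    have hN : 0 < N := NeZero.pos N
    set m : ℤ := -((N : ℤ) * ⌊τ.re / N⌋) with hm
    have hNm : (N : ℤ) ∣ m := dvd_neg.mpr (dvd_mul_right _ _)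
    have hre : |(((m : ℝ)) +ᵥ τ).re| ≤ N := abs_re_vadd_le hN τ
    have him : (((m : ℝ)) +ᵥ τ).im = τ.im := UpperHalfPlane.vadd_im _ _
    rw [← slash_apply_vadd_of_forall_gamma hinv g hNm τ]
    calc ‖(f ∣[k] g) ((m : ℝ) +ᵥ τ)‖ ≤ K' * (((m : ℝ)) +ᵥ τ).im ^ (r + 1 - k) :=
          hK' _ hre (him ▸ h1τ)
      _ = K' * τ.im ^ (r + 1 - k) := by rw [him]
      _ ≤ ε := hA₀ τ.im hA₀τ

/-- **Cusp condition from coefficient growth** (Miyake, Thm. 2.1.4 with Lemma 4.3.3): a weight-`k`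
`Γ(N)`-invariant `f = ∑_{n ≥ 1} aₙ qⁿ` with `|aₙ| ≤ C nʳ` and `r + 1 < k` has `f ∣ₖ g → 0` at `i∞`
for every `g ∈ SL₂(ℤ)`. [cite: DiamondShurman2005, Prop. 1.2.4 and Exercise 1.2.6] -/
theorem isZeroAtImInfty_slash_of_coeff_bound {N : ℕ} [NeZero N] {f : ℍ → ℂ} {k : ℤ} {a : ℕ → ℂ}
    {C r : ℝ} (hr : 0 ≤ r) (hrk : r + 1 < k) (ha : ∀ n, ‖a n‖ ≤ C * (n : ℝ) ^ r) (ha0 : a 0 = 0)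
    (hf : ∀ τ : ℍ, HasSum (fun n : ℕ => a n * Function.Periodic.qParam 1 τ ^ n) (f τ))
    (hinv : ∀ γ ∈ CongruenceSubgroup.Gamma N, f ∣[k] γ = f) (g : SL(2, ℤ)) :
    IsZeroAtImInfty (f ∣[k] g) := by
  obtain ⟨K, hK, hb⟩ := norm_le_mul_im_rpow_neg_of_hasSum hr ha ha0 hf
  exact isZeroAtImInfty_slash_of_norm_le hK hr hrk hb hinv g

/-! ### Packaging: a cusp form in `S_k(N, χ)` with prescribed `q`-expansion -/

/-- `Γ₀(N)`-automorphy with character `χ(d)` gives weight-`k` invariance under `Γ₁(N)`.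
[cite: DiamondShurman2005, §5.2 p. 169] -/
theorem slash_eq_of_forall_gamma0_slash {N : ℕ} [NeZero N] {k : ℤ} (χ : DirichletCharacter ℂ N)
    {f : ℍ → ℂ} (hslash : ∀ γ : Gamma0 N, f ∣[k] mapGL ℝ (γ : SL(2, ℤ)) = χ (Gamma0Map N γ) • f)
    {γ : SL(2, ℤ)} (hγ : γ ∈ Gamma1 N) : f ∣[k] γ = f := by
  have hγ0 : γ ∈ Gamma0 N := Gamma1_in_Gamma0 N hγ
  have h := hslash ⟨γ, hγ0⟩
  have h1 : Gamma0Map N ⟨γ, hγ0⟩ = 1 := by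
    rw [Gamma1_mem] at hγ
    exact hγ.2.1
  rw [h1, map_one, one_smul] at h
  rw [ModularForm.SL_slash]
  exact h

/-- **Cusp forms in `S_k(N, χ)` from `q`-series** (the packaging step of Miyake, Thm. 4.8.2;
Diamond–Shurman Prop. 1.2.4 and §5.2): let `f(τ) = ∑_{n ≥ 1} aₙ e^{2πinτ}` on `ℍ` with
`|aₙ| ≤ C nʳ`, `r + 1 < k`, and `f ∣ₖ γ = χ(d_γ) f` for all `γ ∈ Γ₀(N)`. Then `f` is (the
underlying function of) a cusp form `g ∈ S_k(Γ₁(N))` lying in the `χ`-eigenspace `S_k(N, χ)` of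
the diamond operators, with `q`-expansion coefficients `aₙ(g) = aₙ`.
[cite: DiamondShurman2005, Prop. 1.2.4 and Exercise 1.2.6] [cite: Miyake2006, Thm. 2.1.4, Lemma 4.3.3] -/
theorem exists_cuspForm_of_hasSum {N : ℕ} [NeZero N] {k : ℤ} (χ : DirichletCharacter ℂ N)
    {f : ℍ → ℂ} {a : ℕ → ℂ} {C r : ℝ} (hr : 0 ≤ r) (hrk : r + 1 < k)
    (ha : ∀ n, ‖a n‖ ≤ C * (n : ℝ) ^ r) (ha0 : a 0 = 0)
    (hf : ∀ τ : ℍ, HasSum (fun n : ℕ => a n * Function.Periodic.qParam 1 τ ^ n) (f τ))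
    (hslash : ∀ γ : Gamma0 N, f ∣[k] mapGL ℝ (γ : SL(2, ℤ)) = χ (Gamma0Map N γ) • f) :
    ∃ g : CuspForm (Gamma1 N) k, (⇑g : ℍ → ℂ) = f ∧ g ∈ nebentypusSubspace N k χ ∧
      ∀ n : ℕ, (qExpansion 1 ⇑g).coeff n = a n := by
  have hinv1 : ∀ γ ∈ Gamma1 N, f ∣[k] γ = f := fun γ hγ => slash_eq_of_forall_gamma0_slash χ hslash hγ
  have hinv : ∀ γ ∈ CongruenceSubgroup.Gamma N, f ∣[k] γ = f := fun γ hγ =>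
    hinv1 γ (Gamma_le_Gamma1 N hγ)
  -- holomorphy, from the polynomial coefficient bound
  have hC : 0 ≤ C := by
    have h := (norm_nonneg (a 1)).trans (ha 1)
    simpa using h
  have ha' : ∀ n, ‖a n‖ ≤ C * ((n : ℝ) + 1) ^ ⌈r⌉₊ := by
    intro n
    refine (ha n).trans (mul_le_mul_of_nonneg_left ?_ hC)
    have hn : (0 : ℝ) ≤ n := Nat.cast_nonneg n
    calc (n : ℝ) ^ r ≤ ((n : ℝ) + 1) ^ r := Real.rpow_le_rpow hn (by linarith) hr
      _ ≤ ((n : ℝ) + 1) ^ ((⌈r⌉₊ : ℕ) : ℝ) :=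
          Real.rpow_le_rpow_of_exponent_le (by linarith) (Nat.le_ceil r)
      _ = ((n : ℝ) + 1) ^ ⌈r⌉₊ := Real.rpow_natCast _ _
  have hf' : ∀ z : ℍ, f z = ∑' n : ℕ, a n * cexp (2 * π * Complex.I * z) ^ n := by
    intro z
    rw [← (hf z).tsum_eq]
    congr 1
    funext n
    simp [Function.Periodic.qParam]
  have hhol : MDifferentiable 𝓘(ℂ) 𝓘(ℂ) f := mdifferentiable_of_eq_qSeries ha' hf'
  -- the cusp form
  let g : CuspForm (Gamma1 N) k :=
    { toFun := f
      slash_action_eq' := fun γ hγ => by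
        obtain ⟨γ₀, hγ₀, rfl⟩ := Subgroup.mem_map.mp hγ
        have h := hinv1 γ₀ hγ₀
        rwa [ModularForm.SL_slash] at h
      holo' := hhol
      zero_at_cusps' := fun {c} hc => by
        rw [Subgroup.IsArithmetic.isCusp_iff_isCusp_SL2Z] at hc
        rw [OnePoint.isZeroAt_iff_forall_SL2Z hc]
        intro A _
        exact isZeroAtImInfty_slash_of_coeff_bound hr hrk ha ha0 hf hinv A }
  have hcoe : (⇑g : ℍ → ℂ) = f := rfl
  refine ⟨g, hcoe, ?_, fun n => ?_⟩
  · exact mem_nebentypusSubspace_of_forall_slash fun γ => by rw [hcoe]; exact hslash γ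
  · symm
    refine ModularFormClass.qExpansion_coeff_unique one_pos
      (HeckeTGamma1.one_mem_strictPeriods_Gamma1 N) (f := g) (fun τ => ?_) n
    simpa only [smul_eq_mul, hcoe] using hf τ

end Literature.NumberTheory.EllipticCurves.ModularForms
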